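/-
Copyright (c) 2026 the pub-hodgecm-mathlib formalisation cell (harness21).  Prover seat hodgecm-mathlib-A-p14 (g32), P6 «MOD programme»,
board offer (ν2) of A-p17 (g26)՚s FINDING «G1c base is not Dedekind» (19:09:56Z), algebraic half; 2026-09-01.
-/
import Literature.AlgebraicGeometry.AbelianSchemes.AbelianSchemeMorphismSpread
import Mathlib.RingTheory.Algebraic.Integral
import Mathlib.RingTheory.IntegralClosure.IsIntegralClosure.Basic
import HarnessLib

/-!
# Over an ALGEBRAIC field extension the stage of the morphism spread is a FINITE FIELD EXTENSION
# (EGA IV₃ 8.8.2 (i) + «a finitely generated domain algebraic over a field is a field, finite over it»)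

Topic `AlgebraicGeometry/AbelianSchemes`, namespace `Literature.AlgebraicGeometry.AbelianSchemes.AbelianScheme`.  THEOREMS ONLY (no definition, no named fact, no
`instance`, no notation, no `sorry`).  Cell `hodgecm-mathlib` (D-0151), F0/P6 «MOD», board offer **(ν2) «HOMS OVER `Ω` DESCEND TO A FINITE STAGE»** (A-p17 (g26)
FINDING 19:09:56Z: the base `R = 𝒪_{Ω}` of the P6a roof is a rank-one NON-noetherian valuation ring, so every Dedekind-based ★ engine must be fed through a FINITE
stage `L′ ⊇ L` inside `Ω`; this file is the ALGEBRAIC half of that reduction, the Néron∕group-law half is (ν3)); sequel of ★ `AbelianSchemeMorphismSpread` (p611149,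
this seat՚s lineage); `--supports stmt-HodgeConjecture-24832`, COUNT-NEUTRAL.  HONEST LABEL: HC_CM is proved only modulo the 2 remaining named inputs (hLiu418 24832,
h413 24833) until rung 0 closes; this file discharges none of them.

## Mathematics

(§1, pure algebra) Let `k` be a field, `Ω ⊇ k` an ALGEBRAIC extension, `R` a DOMAIN of finite type over `k` with an INJECTIVE `k`-algebra map `χ : R → Ω`.  Then `R` is
algebraic over `k` (Mathlib `Algebra.IsAlgebraic.of_injective`), hence integral (`k` a field), hence a FIELD (`isField_of_isIntegral_of_isField'`) and MODULE-FINITE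
over `k` (`Algebra.IsIntegral.finite`): the stages `R = T[t] ⊆ Ω` of EGA IV₃ 8.8.2 are finite field extensions `L′` of `k`.  (§2) Consequently ★
`exists_stage_hom_baseChange_eq_of_algHom` (spreading a `Ω`-morphism `X ×_k Ω → 𝒜_Ω` into an abelian scheme to a stage) yields, for `Ω∕k` algebraic, a stage that is a
FIELD `L′`, finite over `k`, with `k ⊆ L′ ⊆ Ω`: a morphism (e.g. a homomorphism of abelian varieties, `X := 𝒜′.X`) defined over `Ω = k̄` is defined over a finite
extension of `k` ([EGAIV3] Thm. 8.8.2 (i); [GortzWedhorn2020] Thm. 10.57 «spreading out»; [MilneAV2008] I §1 — the classical «a morphism defined over `k̄` is defined over a finite extension»).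

## Contents

* §1 `isAlgebraic_of_injective_algHom`, **`isField_of_finiteType_of_injective_algHom`**, **`finite_of_finiteType_of_injective_algHom`** (generic, ns
  `Literature.AlgebraicGeometry.AbelianSchemes.FiniteStage`).
* §2 **`AbelianScheme.exists_field_stage_hom_baseChange_eq_of_algHom`** — ★ `exists_stage_hom_baseChange_eq_of_algHom` with the two extra conclusions
  `IsField R` and `Module.Finite k R` when `[Algebra.IsAlgebraic k K]`.

## References
* [EGAIV3] A. Grothendieck, J. Dieudonné, EGA IV₃ (Publ. Math. IHÉS 28, 1966), Thm. 8.8.2 (i).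
* [GortzWedhorn2020] U. Görtz, T. Wedhorn, *Algebraic Geometry I*, 2nd ed. (2020), Thm. 10.57 (spreading out of morphisms).
* [StacksProject] The Stacks Project, Tag 01ZC; Tag 00GB∕030C («a finite type domain over a field which is algebraic is finite»).
-/

set_option autoImplicit false

noncomputable section

universe u

open CategoryTheory CategoryTheory.Limits AlgebraicGeometry MonoidalCategory CartesianMonoidalCategory

namespace Literature.AlgebraicGeometry.AbelianSchemes

/-! ## §1 A finite-type domain embedded in an algebraic extension is a finite field extension -/

namespace FiniteStage

variable {k : Type*} [Field k] {R : Type*} [CommRing R] [Algebra k R] {Ω : Type*} [Field Ω] [Algebra k Ω]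

/-- `R` embeds `k`-linearly into the algebraic extension `Ω` ⇒ `R` is algebraic over `k`. [cite: StacksProject, Tag 030C] -/
theorem isAlgebraic_of_injective_algHom [Algebra.IsAlgebraic k Ω] (χ : R →ₐ[k] Ω) (hχ : Function.Injective χ) :
    Algebra.IsAlgebraic k R :=
  Algebra.IsAlgebraic.of_injective χ hχ

/-- **A DOMAIN `R` with an injective `k`-algebra map into an algebraic extension `Ω` of the field `k` is a FIELD.**
[cite: StacksProject, Tag 030C] [cite: EGAIV3, Thm. 8.8.2 (i)] -/
theorem isField_of_injective_algHom [IsDomain R] [Algebra.IsAlgebraic k Ω] (χ : R →ₐ[k] Ω) (hχ : Function.Injective χ) :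
    IsField R := by
  haveI := isAlgebraic_of_injective_algHom χ hχ
  haveI : Algebra.IsIntegral k R := Algebra.IsAlgebraic.isIntegral
  exact isField_of_isIntegral_of_isField' (Field.toIsField k)

/-- **… and if moreover `R` is of finite type over `k`, it is MODULE-FINITE over `k`** (a finite field extension). [cite: StacksProject, Tag 030C] -/
theorem finite_of_finiteType_of_injective_algHom [Algebra.FiniteType k R] [Algebra.IsAlgebraic k Ω] (χ : R →ₐ[k] Ω)
    (hχ : Function.Injective χ) : Module.Finite k R := by
  haveI := isAlgebraic_of_injective_algHom χ hχ
  haveI : Algebra.IsIntegral k R := Algebra.IsAlgebraic.isIntegral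
  exact Algebra.IsIntegral.finite

end FiniteStage

/-! ## §2 The morphism spread with a FIELD stage -/

namespace AbelianScheme

open Literature.AlgebraicGeometry.Motives (SchemeOver specOver AbelianVariety)
open Literature.AlgebraicGeometry.Limits Literature.AlgebraicGeometry.Limits.SubalgApprox
open scoped MonObj Obj

set_option backward.isDefEq.respectTransparency false

variable {k : Type u} [Field k] {T : Type u} [CommRing T] [Algebra k T] {K : Type u} [Field K]

/-- **SPREADING A MORPHISM TO A FINITE FIELD STAGE** ([EGAIV3] 8.8.2 (i) over an ALGEBRAIC extension `K ⊇ k`): for `T` of finite type over `k` with a `k`-algebra map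
`ψ : T → K`, an abelian scheme `𝒜∕T`, a quasi-compact quasi-separated `k`-scheme `X` and a `K`-morphism `f : X ×_k K → 𝒜_ψ`, there is a stage `R` as in ★
`exists_stage_hom_baseChange_eq_of_algHom` — a domain of finite type over `k` with `φ : T → R`, an injective `χ : R →ₐ[k] K`, `χ ∘ φ = ψ`, and an `R`-morphism
`F : X ×_k R → 𝒜_R` with `F ×_R K = srcFacIso ≫ f ≫ fibreFacIso⁻¹`, unit-preserving on rational points — which is moreover a FIELD, MODULE-FINITE over `k` (§1).
[cite: EGAIV3, Thm. 8.8.2 (i)] [cite: GortzWedhorn2020, Thm. 10.57] [cite: StacksProject, Tag 01ZC] -/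
theorem exists_field_stage_hom_baseChange_eq_of_algHom [Algebra k K] [Algebra.IsAlgebraic k K] [Algebra.FiniteType k T] (ψ : T →ₐ[k] K)
    (𝒜 : AbelianScheme T) (X : SchemeOver k) [QuasiCompact X.hom] [QuasiSeparated X.hom]
    (f : (Over.pullback (specMap (algebraMap k K))).obj X ⟶ (𝒜.fibre ψ.toRingHom).X) :
    ∃ (R : Type u) (_ : CommRing R) (_ : IsDomain R) (_ : Algebra k R) (_ : Algebra.FiniteType k R)
      (φ : T →+* R) (_ : φ.comp (algebraMap k T) = algebraMap k R)
      (χ : R →ₐ[k] K) (_ : Function.Injective χ) (hχ : χ.toRingHom.comp φ = ψ.toRingHom)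
      (hσ' : χ.toRingHom.comp (algebraMap k R) = algebraMap k K)
      (F : (Over.pullback (specMap (algebraMap k R))).obj X ⟶ (𝒜.baseChange φ).X),
      IsField R ∧ Module.Finite k R ∧
      (Over.pullback (specMap χ.toRingHom)).map F =
          (srcFacIso χ.toRingHom (algebraMap k K) hσ' X).hom ≫ f ≫ (𝒜.fibreFacIso φ χ.toRingHom ψ.toRingHom hχ).inv.hom.hom.hom ∧
        ∀ P : 𝟙_ (SchemeOver k) ⟶ X, (Over.pullback (specMap (algebraMap k K))).map P ≫ f = 1 →
          (Over.pullback (specMap (algebraMap k R))).map P ≫ F = 1 := by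
  obtain ⟨R, _, _, _, _, φ, hφ, χ, hχinj, hχ, hσ', F, hF, hP⟩ := exists_stage_hom_baseChange_eq_of_algHom ψ 𝒜 X f
  exact ⟨R, inferInstance, inferInstance, inferInstance, inferInstance, φ, hφ, χ, hχinj, hχ, hσ', F,
    FiniteStage.isField_of_injective_algHom χ hχinj, FiniteStage.finite_of_finiteType_of_injective_algHom χ hχinj, hF, hP⟩

end AbelianScheme

end Literature.AlgebraicGeometry.AbelianSchemes
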